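import Mathlib
import Summits.ResolutionOfSingularities.ResolutionOfSingularities.Theorems.WildQuotientsWildQuotientResolutionJordanFiveTwistedChart
import Summits.ResolutionOfSingularities.ResolutionOfSingularities.Theorems.WildQuotientsWildQuotientResolutionJordanFourTwistedChartAction

/-!
# R-T rung (J₅) — the action of `⟨σ⟩` through the universal twisted chart: `ψ₅ ∘ g = Σ_l^m ∘ ψ₅` for every `g ∈ ⟨σ⟩`

(crux stmt-ResolutionOfSingularities-15640 `WildQuotients.WildQuotientResolution`, line `Sketch`,
sector `|G| = p`; programme «R-T twisted root charts in general» of `L/w45c/CHAIN.md` v7.9 §5;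
res-L1-w45c-plan-1 NAMING 2026-08-27T09:46:51Z («… and the intertwining law with Σ (the
`twistedChart_pow_apply` analogue)»). [OURS · L1 W4.5c] — NOT a statement of any manuscript
(Hironaka 2017 is consumed nowhere); replaces the role of no printed item. Prover res-L1-w45c-stub-1.
AI-written Lean, kernel-checked; weaker than expert review.)

The generic half lives in `…JordanFourTwistedChartAction` (`JordanFour.map_pow_apply_of_intertwines`,
`exists_expo_of_intertwines`, `exists_expo_algebraMap_and_fixed_iff`, …) and is imported, not
restated. This file instantiates it at `ψ₅ = JordanFive.twistedChart k n a b c d e`, the `J₅` datum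
`σ` (`x_b ↦ x_b + x_a`, …, `x_e ↦ x_e + x_d`, an algebra AUTOMORPHISM given by its law) and the
translation `Σ_l` (ANY endomorphism with `ξ ↦ ξ + l`, other variables fixed), using T5-i
`JordanFive.twistedChart_map`:
* `twistedChart_pow_apply`: `ψ₅ ∘ σ^m = Σ_l^m ∘ ψ₅`;
* `twistedChart_toRingEquiv_zpowers_self`, `exists_twistedChart_toRingEquiv_eq_pow`,
  `exists_twistedChart_expo`: every `g ∈ ⟨σ⟩` (finite) acts on the chart as a power of `Σ_l`, with one
  exponent function normalised by `m σ = 1`;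
* `exists_twistedChart_expo_algebraMap_and_fixed_iff`: the ring-brick input — for any `k[x]`-algebra
  `S` with an endomorphism `τS` over `Σ_l`, the intertwining for every `g` and «fixed by all
  `τS^{m g}`» = «`τS`-fixed» (so `⟨σ⟩`-invariants read through `ψ₅` = `Σ_l`-fixed elements, to be
  combined with `ToricExit.fixedPoints_translate`).
-/

-- single-problem summit: the doubled namespace component `ResolutionOfSingularities` is forced
set_option linter.dupNamespace false

noncomputable section

open MvPolynomial

namespace Summit.ResolutionOfSingularities.ResolutionOfSingularities.Theorems.WildQuotientResolution.JordanFive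

section Twisted

variable (k : Type) [Field k] (n : ℕ) (a b c d e : Fin n)
  (hab : a ≠ b) (hac : a ≠ c) (had : a ≠ d) (hae : a ≠ e) (hbc : b ≠ c) (hbd : b ≠ d) (hbe : b ≠ e)
  (hcd : c ≠ d) (hce : c ≠ e) (hde : d ≠ e)
  (τ : MvPolynomial (Fin n) k →ₐ[k] MvPolynomial (Fin n) k)
  (hτc : τ (X c) = X c + X b) (hτ : ∀ i, i ≠ c → τ (X i) = X i)
  (σ : MvPolynomial (Fin n) k ≃ₐ[k] MvPolynomial (Fin n) k)
  (hσb : σ (X b) = X b + X a) (hσc : σ (X c) = X c + X b) (hσd : σ (X d) = X d + X c)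
  (hσe : σ (X e) = X e + X d)
  (hσ : ∀ i, i ≠ b → i ≠ c → i ≠ d → i ≠ e → σ (X i) = X i)

include hab hac had hae hbc hbd hbe hcd hce hde hτc hτ hσb hσc hσd hσe hσ in
/-- **`ψ₅ ∘ σ^m = Σ_l^m ∘ ψ₅`**: the `m`-th iterate of the wild automorphism is, on the universal
twisted chart, the translation `ξ ↦ ξ + m l`. [OURS · L1 W4.5c] -/
theorem twistedChart_pow_apply (h2 : (2 : k) ≠ 0) (h3 : (3 : k) ≠ 0) (m : ℕ)
    (f : MvPolynomial (Fin n) k) :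
    twistedChart k n a b c d e ((σ ^ m) f) = (τ ^ m) (twistedChart k n a b c d e f) :=
  JordanFour.map_pow_apply_of_intertwines (twistedChart k n a b c d e) σ τ
    (twistedChart_map k n a b c d e hab hac had hae hbc hbd hbe hcd hce hde τ hτc hτ
      (σ : MvPolynomial (Fin n) k →ₐ[k] MvPolynomial (Fin n) k) hσb hσc hσd hσe hσ h2 h3) m f

include hab hac had hae hbc hbd hbe hcd hce hde hτc hτ hσb hσc hσd hσe hσ in
/-- The generator in affine-quotient-law form: `ψ₅ (toRingEquiv ⟨σ⟩ k[x] σ f) = Σ_l (ψ₅ f)`.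
[OURS · L1 W4.5c] -/
theorem twistedChart_toRingEquiv_zpowers_self (h2 : (2 : k) ≠ 0) (h3 : (3 : k) ≠ 0)
    (f : MvPolynomial (Fin n) k) :
    twistedChart k n a b c d e (MulSemiringAction.toRingEquiv (Subgroup.zpowers σ)
        (MvPolynomial (Fin n) k) ⟨σ, Subgroup.mem_zpowers σ⟩ f) =
      τ (twistedChart k n a b c d e f) :=
  JordanFour.map_toRingEquiv_zpowers_self (twistedChart k n a b c d e) σ τ
    (twistedChart_map k n a b c d e hab hac had hae hbc hbd hbe hcd hce hde τ hτc hτ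
      (σ : MvPolynomial (Fin n) k →ₐ[k] MvPolynomial (Fin n) k) hσb hσc hσd hσe hσ h2 h3) f

include hab hac had hae hbc hbd hbe hcd hce hde hτc hτ hσb hσc hσd hσe hσ in
/-- **Every `g ∈ ⟨σ⟩` is a power of `Σ_l` on the chart**: `∃ m, ψ₅ (g • f) = Σ_l^m (ψ₅ f)` for all
`f` (finite `⟨σ⟩`). [OURS · L1 W4.5c] -/
theorem exists_twistedChart_toRingEquiv_eq_pow (h2 : (2 : k) ≠ 0) (h3 : (3 : k) ≠ 0)
    [Finite (Subgroup.zpowers σ)] (g : Subgroup.zpowers σ) :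
    ∃ m : ℕ, ∀ f : MvPolynomial (Fin n) k,
      twistedChart k n a b c d e (MulSemiringAction.toRingEquiv (Subgroup.zpowers σ)
          (MvPolynomial (Fin n) k) g f) =
        (τ ^ m) (twistedChart k n a b c d e f) :=
  JordanFour.exists_map_toRingEquiv_eq_pow (twistedChart k n a b c d e) σ τ
    (twistedChart_map k n a b c d e hab hac had hae hbc hbd hbe hcd hce hde τ hτc hτ
      (σ : MvPolynomial (Fin n) k →ₐ[k] MvPolynomial (Fin n) k) hσb hσc hσd hσe hσ h2 h3) g

include hab hac had hae hbc hbd hbe hcd hce hde hτc hτ hσb hσc hσd hσe hσ in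
/-- One exponent function for `⟨σ⟩` on the chart, normalised by `m σ = 1`. [OURS · L1 W4.5c] -/
theorem exists_twistedChart_expo (h2 : (2 : k) ≠ 0) (h3 : (3 : k) ≠ 0)
    [Finite (Subgroup.zpowers σ)] :
    ∃ m : Subgroup.zpowers σ → ℕ, m ⟨σ, Subgroup.mem_zpowers σ⟩ = 1 ∧
      ∀ (g : Subgroup.zpowers σ) (f : MvPolynomial (Fin n) k),
        twistedChart k n a b c d e (MulSemiringAction.toRingEquiv (Subgroup.zpowers σ)
            (MvPolynomial (Fin n) k) g f) =
          (τ ^ m g) (twistedChart k n a b c d e f) :=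
  JordanFour.exists_expo_of_intertwines (twistedChart k n a b c d e) σ τ
    (twistedChart_map k n a b c d e hab hac had hae hbc hbd hbe hcd hce hde τ hτc hτ
      (σ : MvPolynomial (Fin n) k →ₐ[k] MvPolynomial (Fin n) k) hσb hσc hσd hσe hσ h2 h3)

include hab hac had hae hbc hbd hbe hcd hce hde hτc hτ hσb hσc hσd hσe hσ in
/-- **The ring-brick input.** For any `k[x]`-algebra `S` with an endomorphism `τS` over `Σ_l`
(`τS ∘ algebraMap = algebraMap ∘ Σ_l`), one exponent function `m : ⟨σ⟩ → ℕ` (`m σ = 1`) gives, for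
every `g ∈ ⟨σ⟩`, `τS^{m g} (ψ₅ f) = ψ₅ (g • f)` in `S`, and an element of `S` is fixed by all
`τS^{m g}` iff it is `τS`-fixed. [OURS · L1 W4.5c] -/
theorem exists_twistedChart_expo_algebraMap_and_fixed_iff (h2 : (2 : k) ≠ 0) (h3 : (3 : k) ≠ 0)
    [Finite (Subgroup.zpowers σ)] {S : Type*} [CommRing S] [Algebra k S]
    [Algebra (MvPolynomial (Fin n) k) S] (τS : S →ₐ[k] S)
    (hτS : ∀ r, τS (algebraMap (MvPolynomial (Fin n) k) S r) =
      algebraMap (MvPolynomial (Fin n) k) S (τ r)) :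
    ∃ m : Subgroup.zpowers σ → ℕ, m ⟨σ, Subgroup.mem_zpowers σ⟩ = 1 ∧
      (∀ (g : Subgroup.zpowers σ) (f : MvPolynomial (Fin n) k),
        (τS ^ m g) (algebraMap (MvPolynomial (Fin n) k) S (twistedChart k n a b c d e f)) =
          algebraMap (MvPolynomial (Fin n) k) S (twistedChart k n a b c d e
            (MulSemiringAction.toRingEquiv (Subgroup.zpowers σ) (MvPolynomial (Fin n) k) g f))) ∧
      ∀ x : S, (∀ g : Subgroup.zpowers σ, (τS ^ m g) x = x) ↔ τS x = x :=
  JordanFour.exists_expo_algebraMap_and_fixed_iff (twistedChart k n a b c d e) σ τ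
    (twistedChart_map k n a b c d e hab hac had hae hbc hbd hbe hcd hce hde τ hτc hτ
      (σ : MvPolynomial (Fin n) k →ₐ[k] MvPolynomial (Fin n) k) hσb hσc hσd hσe hσ h2 h3)
    τS hτS

end Twisted

end Summit.ResolutionOfSingularities.ResolutionOfSingularities.Theorems.WildQuotientResolution.JordanFive

end
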